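import Summits.QuantumFields.BalabanUV.T4Continuum.Support.EffectiveLaplacianSymbolBound
import Summits.QuantumFields.BalabanUV.T4Continuum.Support.ScalarSandwichReduction
import Summits.QuantumFields.BalabanUV.T4Continuum.Support.ScalarLayerKronBridge
import Summits.QuantumFields.BalabanUV.T4Continuum.Support.CovariantDivergencePlantingTower

/-!
# T⁴ programme, spine node NE2 (U1a), tier B support row B4.d — THE END: the effective-Laplacian excess on 0-forms and the
# UNCONDITIONAL `U = 1` scalar free-tower laws `freeTowerLaws_king_scalar` (file 9 of row B4.d)

NE2 formalisation swarm `b2b-balaban-t4-ne2-formalise-*`, seat LEAF PROVER 04, support row B4.d of `t4/formal/NE2/LEAVES.md`.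
Parts 1–2 (`EffectiveLaplacianSymbol`, `EffectiveLaplacianSymbolBound`) proved on the VECTOR index
`Re⟨w, (effOp Δ′ J − Δ)w⟩ ≤ (C_m(d)/N²)·nsq(Δw)`.  This file reads it on 0-forms through the Kronecker / component-embedding bridge
and discharges the hypothesis `hX` of `ScalarSandwichReduction.freeTowerLaws_scalar_of_excess`:

 * §1 `Qavg = Qavg0 ⊗ 1`, `JK = JK0 ⊗ 1`, `lap = LapS ⊗ 1` (row B4.c's `ScalarLayerKronBridge.Lap_eq_kron`), **`effOp_kron`**:
   `effOp (A ⊗ 1) (J ⊗ 1) = effOp A J ⊗ 1`, `admissible_kron`; hence `effOp Δ′_vec J_vec = effLap ⊗ 1`;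
 * §2 `(X ⊗ 1)·emb_μ = emb_μ·X`, `⟨emb v, emb u⟩ = ⟨v, u⟩`, and **`re_form_effLap_sub_LapS_le`**:
   `Re⟨v, (Δ̃ − Δ)v⟩ ≤ (C_m(d)/N²)·nsq(Δv)` on 0-forms;
 * §3 `‖Δ·G′‖ ≤ 1 + a′γ′⁻¹` and **`excess_Gps_le`**: `Re⟨G′v, (Δ̃ − Δ)G′v⟩ ≤ C_m(d)(1 + a′γ′⁻¹)²/N²·nsq v`;
 * §4 **`freeTowerLaws_king_scalar (hd : 0 < d) (ha′ : 0 < a′)`** — ROW B4.d's END, hypothesis-free: the `U = 1` scalar tower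
   `DeltaPs (L^k) M a′` with King's 0-form averagings `Q0lev` / plantings `J0pcT` satisfies `BackgroundResolventTower.FreeTowerLaws` with
   pairing defect `0`, complement defect `2d√(γ′⁻¹)·L^{−k}` and injected defect `(2d√(γ′⁻¹) + C_m(d)(1 + a′γ′⁻¹)²)·L^{−k}`;
   plus the bridge `J0pcT_eq_JK0T` to row B4.f's retyped planting (leaf-05's `J0 k = JK0T L M k ⊗ 1`).

HONEST FRAMING (T4-DAG p. 1).  `U = 1`, FIXED FINITE torus, free scalar layer; linear algebra + finite Fourier analysis, statements /
constants OURS ([folklore]); the «free scalar-tower planting/complement defects» DATA of row B4.b (leaf-05's interface note), NOT B4, NOT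
[Balaban1985BackgroundPropagators] (3.23)–(3.26) as printed; NE2 NOT proved; NOT infinite volume / mass gap / Clay / summit progress; spine
0/9 unchanged.  HONEST DEPENDENCY: continuum YM on T⁴ ⇐ BetaPertH ∧ nine spine estimates (0/9 proved); BetaPertH ⇐ (D1) ∧ (D4) ∧ CAP+tail;
G-an2-4 gates asym, D1 and NE2/3/4.  No `sorry`.
-/

noncomputable section

open scoped BigOperators ComplexConjugate ComplexOrder Matrix Matrix.Norms.L2Operator Kronecker

namespace Summit.QuantumFields.BalabanUV.T4Continuum.EffectiveLaplacianExcess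

open Literature.MathematicalPhysics.QuantumFieldTheory.Balaban1983to89.B5Prop11Plancherel
open Literature.MathematicalPhysics.QuantumFieldTheory.Balaban1983to89.B5Prop11Lower (nsq nsq_nonneg star_dotProduct_self nsq_mulVec_le Lap)
open Literature.MathematicalPhysics.QuantumFieldTheory.Balaban1983to89.B5Action121 (shiftS sdiff LapS)
open Literature.MathematicalPhysics.QuantumFieldTheory.Balaban1983to89.B5G183RateTorusW (Qavg)
open Literature.MathematicalPhysics.QuantumFieldTheory.Balaban1983to89.B5G183RateUnitTower (lev lev_neZero)
open Summit.QuantumFields.BalabanUV.T4Continuum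
open Summit.QuantumFields.BalabanUV.T4Continuum.BackgroundResolventTower (FreeTowerLaws)
open Summit.QuantumFields.BalabanUV.T4Continuum.BalabanAveragedTowerUnit (one_le_lev' cast_lev')
open Summit.QuantumFields.BalabanUV.T4Continuum.BalabanAveragedTowerModes (par)
open Summit.QuantumFields.BalabanUV.T4Continuum.KingPairingPlantedLaw (JK sqrt_facts)
open Summit.QuantumFields.BalabanUV.T4Continuum.AbelianCovariantLaplacian (lap)
open Summit.QuantumFields.BalabanUV.T4Continuum.OneStepEffectiveOperator
open Summit.QuantumFields.BalabanUV.T4Continuum.KroneckerLift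
open Summit.QuantumFields.BalabanUV.T4Continuum.ScalarBlockPoincare (PiS nsq_PiS_mulVec_le)
open Summit.QuantumFields.BalabanUV.T4Continuum.ScalarAveragedPropagator (DeltaPs gammaPs Gps gammaPs_pos opNorm_le_of_nsq_le_rect
  opNorm_Gps_le DeltaPs_mul_Gps isUnit_det_DeltaPs)
open Summit.QuantumFields.BalabanUV.T4Continuum.ScalarBlockPlanting
open Summit.QuantumFields.BalabanUV.T4Continuum.ScalarPlantingDefect (Q0lev J0pcT)
open Summit.QuantumFields.BalabanUV.T4Continuum.ScalarSandwichReduction (effLap effLapLev admissible_LapS_JK0 freeTowerLaws_scalar_of_excess)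
open Summit.QuantumFields.BalabanUV.T4Continuum.ScalarLayerKronBridge (Lap_eq_kron)
open Summit.QuantumFields.BalabanUV.T4Continuum.EffectiveLaplacianSymbol
open Summit.QuantumFields.BalabanUV.T4Continuum.EffectiveLaplacianSymbolBound

variable {d : ℕ}

/-! ## §1 Kronecker forms of the plantings and of the effective operator -/

section Kron

variable {m n : Type*} [Fintype m] [Fintype n] [DecidableEq m] [DecidableEq n] (o : Type*) [Fintype o] [DecidableEq o]

/-- **the effective operator lifts componentwise**: `effOp (A ⊗ 1) (J ⊗ 1) = effOp A J ⊗ 1`. [folklore] -/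
theorem effOp_kron (A : Matrix m m ℂ) (J : Matrix m n ℂ) :
    effOp (A ⊗ₖ (1 : Matrix o o ℂ)) (J ⊗ₖ (1 : Matrix o o ℂ)) = effOp A J ⊗ₖ (1 : Matrix o o ℂ) := by
  have hreg : regOp (A ⊗ₖ (1 : Matrix o o ℂ)) (J ⊗ₖ (1 : Matrix o o ℂ)) = regOp A J ⊗ₖ (1 : Matrix o o ℂ) := by
    rw [regOp, regOp, kron_conjTranspose, ← kron_mul, Matrix.add_kronecker]
  have hsw : sandwichReg (A ⊗ₖ (1 : Matrix o o ℂ)) (J ⊗ₖ (1 : Matrix o o ℂ)) = sandwichReg A J ⊗ₖ (1 : Matrix o o ℂ) := by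
    rw [sandwichReg, sandwichReg, hreg, kron_inv, kron_conjTranspose, ← kron_mul, ← kron_mul]
  rw [effOp, effOp, hsw, kron_inv, sub_kronecker, Matrix.one_kronecker_one]

variable {o} in
/-- admissibility lifts componentwise (nonempty fibre). [folklore] -/
theorem admissible_kron [Nonempty o] {A : Matrix m m ℂ} {J : Matrix m n ℂ} (h : Admissible A J) :
    Admissible (A ⊗ₖ (1 : Matrix o o ℂ)) (J ⊗ₖ (1 : Matrix o o ℂ)) := by
  have hreg : regOp (A ⊗ₖ (1 : Matrix o o ℂ)) (J ⊗ₖ (1 : Matrix o o ℂ)) = regOp A J ⊗ₖ (1 : Matrix o o ℂ) := by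
    rw [regOp, regOp, kron_conjTranspose, ← kron_mul, Matrix.add_kronecker]
  have hsw : sandwichReg (A ⊗ₖ (1 : Matrix o o ℂ)) (J ⊗ₖ (1 : Matrix o o ℂ)) = sandwichReg A J ⊗ₖ (1 : Matrix o o ℂ) := by
    rw [sandwichReg, sandwichReg, hreg, kron_inv, kron_conjTranspose, ← kron_mul, ← kron_mul]
  refine ⟨?_, ?_, ?_⟩
  · rw [kron_conjTranspose, ← kron_mul, h.isometry, Matrix.one_kronecker_one]
  · rw [hreg, Matrix.isUnit_iff_isUnit_det]
    exact isUnit_det_kron o ((Matrix.isUnit_iff_isUnit_det _).mp h.isUnit_reg)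
  · rw [hsw, Matrix.isUnit_iff_isUnit_det]
    exact isUnit_det_kron o ((Matrix.isUnit_iff_isUnit_det _).mp h.isUnit_sandwich)

end Kron

section Plantings

variable (N R : ℕ) [NeZero N] [NeZero R] (M : Fin d → ℕ) [hM : ∀ μ, NeZero (M μ)]

/-- King's vector-index averaging is the 0-form averaging tensored with `1`: `Qavg = Qavg0 ⊗ 1`. [folklore] -/
theorem Qavg_eq_kron : Qavg N R M = Qavg0 N R M ⊗ₖ (1 : Matrix (Fin d) (Fin d) ℂ) := by
  ext ⟨y, μ⟩ ⟨x, ν⟩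
  rw [Qavg_apply, Matrix.kroneckerMap_apply]
  simp only [Qavg0, Matrix.one_apply, Prod.mk.injEq, mul_ite, mul_one, mul_zero]
  by_cases h1 : par N R M x = y <;> by_cases h2 : μ = ν
  · subst h2; simp [h1]
  · simp [h1, h2, Ne.symm h2]
  · simp [h1, h2]
  · simp [h1, Ne.symm h2]

/-- `JK = JK0 ⊗ 1`. [folklore] -/
theorem JK_eq_kron : JK N R M = JK0 N R M ⊗ₖ (1 : Matrix (Fin d) (Fin d) ℂ) := by
  rw [JK, JK0, Qavg_eq_kron, kron_conjTranspose, Matrix.smul_kronecker]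

omit [NeZero R] in
/-- the route's free vector Laplacian is b05's `Lap`, i.e. `LapS ⊗ 1`. [folklore] -/
theorem lap_eq_kron (n : ℕ) [NeZero n] : lap (fine n M) (n : ℂ) = LapS (fine n M) (n : ℂ) ⊗ₖ (1 : Matrix (Fin d) (Fin d) ℂ) := by
  rw [show lap (fine n M) (n : ℂ) = Lap n M from rfl]; exact Lap_eq_kron n M

/-- **the vector-index effective Laplacian is the 0-form one tensored with `1`**. [folklore] -/
theorem effOpV_eq_kron :
    effOp (lap (fine (R * N) M) ((R * N : ℕ) : ℂ)) (JK N R M) = effLap N R M ⊗ₖ (1 : Matrix (Fin d) (Fin d) ℂ) := by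
  rw [lap_eq_kron M (R * N), JK_eq_kron, effOp_kron]

/-- admissibility of the vector-index pair (from the 0-form coercivity, `d ≥ 1`). [folklore] -/
theorem admissible_lap_JK (hd : 0 < d) : Admissible (lap (fine (R * N) M) ((R * N : ℕ) : ℂ)) (JK N R M) := by
  haveI : Nonempty (Fin d) := ⟨⟨0, hd⟩⟩
  rw [lap_eq_kron M (R * N), JK_eq_kron]
  exact admissible_kron (admissible_LapS_JK0 N R M)

omit hM in
/-- bridge to row B4.f's retyped planting: `J0pcT = JK0T` (leaf-05's `J0 k = JK0T L M k ⊗ 1`). [folklore] -/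
theorem J0pcT_eq_JK0T (L : ℕ) [NeZero L] (k : ℕ) : J0pcT L M k = CovariantDivergencePlantingTower.JK0T L M k := by
  rw [CovariantDivergencePlantingTower.JK0T_eq, CovariantDivergencePlantingBound.JK0_eq_planting]; rfl

end Plantings

/-! ## §2 Through the component embedding: the excess on 0-forms -/

section ZeroForms

variable (N R : ℕ) [NeZero N] [NeZero R] (M : Fin d → ℕ) [hM : ∀ μ, NeZero (M μ)]

/-- `(X ⊗ 1)·emb_μ = emb_μ·X` (rectangular). [folklore] -/
theorem kron_one_mul_emb {A B : Fin d → ℕ} [∀ μ, NeZero (A μ)] [∀ μ, NeZero (B μ)] (X : Matrix (Tor A) (Tor B) ℂ) (μ₀ : Fin d) :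
    (X ⊗ₖ (1 : Matrix (Fin d) (Fin d) ℂ)) * emb B μ₀ = emb A μ₀ * X := by
  ext ⟨x, μ⟩ y
  rw [mul_emb_apply, emb_mul_apply, Matrix.kroneckerMap_apply]
  simp only [Matrix.one_apply, mul_ite, mul_one, mul_zero]

/-- `⟨emb v, emb u⟩ = ⟨v, u⟩`. [folklore] -/
theorem star_emb_mulVec_dotProduct {A : Fin d → ℕ} [∀ μ, NeZero (A μ)] (μ₀ : Fin d) (v u : Tor A → ℂ) :
    star (emb A μ₀ *ᵥ v) ⬝ᵥ (emb A μ₀ *ᵥ u) = star v ⬝ᵥ u := by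
  rw [Matrix.star_mulVec, Matrix.dotProduct_mulVec, Matrix.vecMul_vecMul, embH_mul_emb, Matrix.vecMul_one]

/-- `nsq (emb u) = nsq u`. [folklore] -/
theorem nsq_emb_mulVec {A : Fin d → ℕ} [∀ μ, NeZero (A μ)] (μ₀ : Fin d) (u : Tor A → ℂ) : nsq (emb A μ₀ *ᵥ u) = nsq u := by
  have h := star_emb_mulVec_dotProduct μ₀ u u
  rw [star_dotProduct_self, star_dotProduct_self] at h
  exact_mod_cast h

/-- **THE EFFECTIVE-LAPLACIAN EXCESS ON 0-FORMS**: `Re⟨v, (Δ̃ − Δ)v⟩ ≤ (C_m(d)/N²)·nsq(Δv)`, `Δ̃ = effLap N R M` the one-step effective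
Laplacian of King's 0-form planting. [folklore] -/
theorem re_form_effLap_sub_LapS_le (hd : 0 < d) (hN : 1 ≤ N) (v : Tor (fine N M) → ℂ) :
    (star v ⬝ᵥ ((effLap N R M - LapS (fine N M) (N : ℂ)) *ᵥ v)).re ≤ Cm d / (N : ℝ) ^ 2 * nsq (LapS (fine N M) (N : ℂ) *ᵥ v) := by
  set μ₀ : Fin d := ⟨0, hd⟩
  have h := re_form_effOpV_sub_lap_le N R M hN (admissible_lap_JK N R M hd) (emb (fine N M) μ₀ *ᵥ v)
  rw [effOpV_eq_kron, lap_eq_kron M N, ← sub_kronecker, Matrix.mulVec_mulVec, Matrix.mulVec_mulVec, kron_one_mul_emb, kron_one_mul_emb,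
    ← Matrix.mulVec_mulVec, ← Matrix.mulVec_mulVec, star_emb_mulVec_dotProduct, nsq_emb_mulVec] at h
  exact h

/-! ## §3 Against the massive propagator -/

/-- `‖Π′‖ ≤ 1`. [folklore] -/
theorem opNorm_PiS_le (n : ℕ) [NeZero n] : ‖PiS n M‖ ≤ 1 :=
  opNorm_le_of_nsq_le_rect _ zero_le_one fun v => by rw [one_pow, one_mul]; exact nsq_PiS_mulVec_le n M v

/-- `‖Δ·G′‖ ≤ 1 + a′γ′⁻¹` (`ΔG′ = 1 − a′Π′G′`). [folklore] -/
theorem opNorm_LapS_mul_Gps_le {a' : ℝ} (ha' : 0 < a') :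
    ‖LapS (fine N M) (N : ℂ) * Gps N M a'‖ ≤ 1 + a' * (gammaPs d a')⁻¹ := by
  have e : LapS (fine N M) (N : ℂ) * Gps N M a' = 1 - (a' : ℂ) • (PiS N M * Gps N M a') := by
    have h := DeltaPs_mul_Gps N M ha'
    rw [DeltaPs, Matrix.add_mul, Matrix.smul_mul] at h
    rw [← h, add_sub_cancel_right]
  rw [e]
  calc ‖(1 : Matrix (Tor (fine N M)) (Tor (fine N M)) ℂ) - (a' : ℂ) • (PiS N M * Gps N M a')‖
      ≤ ‖(1 : Matrix (Tor (fine N M)) (Tor (fine N M)) ℂ)‖ + ‖(a' : ℂ) • (PiS N M * Gps N M a')‖ := norm_sub_le _ _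
    _ ≤ 1 + a' * (gammaPs d a')⁻¹ := by
        refine add_le_add (CovariantAveragingTower.opNorm_one_le (ι := fun _ => Tor (fine N M)) 0) ?_
        rw [norm_smul, Complex.norm_real, Real.norm_of_nonneg ha'.le]
        refine mul_le_mul_of_nonneg_left ?_ ha'.le
        calc ‖PiS N M * Gps N M a'‖ ≤ ‖PiS N M‖ * ‖Gps N M a'‖ := Matrix.l2_opNorm_mul _ _
          _ ≤ 1 * (gammaPs d a')⁻¹ := mul_le_mul (opNorm_PiS_le M N) (opNorm_Gps_le N M ha') (norm_nonneg _) zero_le_one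
          _ = (gammaPs d a')⁻¹ := one_mul _

/-- **THE EXCESS AGAINST THE MASSIVE PROPAGATOR**: `Re⟨G′v, (Δ̃ − Δ)G′v⟩ ≤ C_m(d)(1 + a′γ′⁻¹)²/N²·nsq v`. [folklore] -/
theorem excess_Gps_le (hd : 0 < d) {a' : ℝ} (ha' : 0 < a') (hN : 1 ≤ N) (v : Tor (fine N M) → ℂ) :
    (star (Gps N M a' *ᵥ v) ⬝ᵥ ((effLap N R M - LapS (fine N M) (N : ℂ)) *ᵥ (Gps N M a' *ᵥ v))).re
      ≤ Cm d * (1 + a' * (gammaPs d a')⁻¹) ^ 2 / (N : ℝ) ^ 2 * nsq v := by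
  have h1 := re_form_effLap_sub_LapS_le N R M hd hN (Gps N M a' *ᵥ v)
  have h2 : nsq (LapS (fine N M) (N : ℂ) *ᵥ (Gps N M a' *ᵥ v)) ≤ (1 + a' * (gammaPs d a')⁻¹) ^ 2 * nsq v := by
    rw [Matrix.mulVec_mulVec]
    refine (nsq_mulVec_le _ v).trans (mul_le_mul_of_nonneg_right ?_ (nsq_nonneg v))
    exact pow_le_pow_left₀ (norm_nonneg _) (opNorm_LapS_mul_Gps_le N M ha') 2
  have hC : 0 ≤ Cm d / (N : ℝ) ^ 2 := div_nonneg (Cm_nonneg d) (sq_nonneg _)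
  calc _ ≤ Cm d / (N : ℝ) ^ 2 * nsq (LapS (fine N M) (N : ℂ) *ᵥ (Gps N M a' *ᵥ v)) := h1
    _ ≤ Cm d / (N : ℝ) ^ 2 * ((1 + a' * (gammaPs d a')⁻¹) ^ 2 * nsq v) := mul_le_mul_of_nonneg_left h2 hC
    _ = Cm d * (1 + a' * (gammaPs d a')⁻¹) ^ 2 / (N : ℝ) ^ 2 * nsq v := by ring

end ZeroForms

/-! ## §4 THE END of row B4.d: the unconditional `U = 1` scalar free-tower laws -/

section End

variable (L : ℕ) [NeZero L] (M : Fin d → ℕ) [hM : ∀ μ, NeZero (M μ)] {a' : ℝ}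

/-- the injected-defect constant of the scalar tower: `C_X(d, a′) = C_m(d)·(1 + a′γ′⁻¹)²`. [folklore] -/
def CX (d : ℕ) (a' : ℝ) : ℝ := Cm d * (1 + a' * (gammaPs d a')⁻¹) ^ 2

omit [NeZero L] hM in
/-- `C_X ≥ 0`. [folklore] -/
theorem CX_nonneg (d : ℕ) (a' : ℝ) : 0 ≤ CX d a' := mul_nonneg (Cm_nonneg d) (sq_nonneg _)

/-- the excess hypothesis `hX` of `freeTowerLaws_scalar_of_excess`, DISCHARGED along the tower. [folklore] -/
theorem excess_lev (hd : 0 < d) (ha' : 0 < a') (k : ℕ) (v : Tor (fine (lev L k) M) → ℂ) :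
    (star (Gps (lev L k) M a' *ᵥ v) ⬝ᵥ ((effLapLev L M k - LapS (fine (lev L k) M) ((lev L k : ℕ) : ℂ)) *ᵥ (Gps (lev L k) M a' *ᵥ v))).re
      ≤ CX d a' * ((L : ℝ)⁻¹) ^ k * nsq v := by
  have h := excess_Gps_le (lev L k) L M hd ha' (one_le_lev' L k) v
  refine h.trans (mul_le_mul_of_nonneg_right ?_ (nsq_nonneg v))
  rw [cast_lev', ← CX, div_eq_mul_inv, inv_pow]
  refine mul_le_mul_of_nonneg_left ?_ (CX_nonneg d a')
  have hL1 : (1 : ℝ) ≤ (L : ℝ) ^ k := by rw [← cast_lev']; exact_mod_cast one_le_lev' L k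
  have hpos : (0 : ℝ) < (L : ℝ) ^ k := lt_of_lt_of_le one_pos hL1
  rw [inv_le_inv₀ (by positivity) hpos]
  calc (L : ℝ) ^ k = (L : ℝ) ^ k * 1 := (mul_one _).symm
    _ ≤ (L : ℝ) ^ k * (L : ℝ) ^ k := mul_le_mul_of_nonneg_left hL1 hpos.le
    _ = ((L : ℝ) ^ k) ^ 2 := (sq _).symm

/-- **ROW B4.d's END — THE U = 1 SCALAR FREE-TOWER LAWS (hypothesis-free; `d ≥ 1`, `a′ > 0`).**  The scalar tower
`Δ′_k = LapS + a′•PiS` on `T^{(k)} = (ℤ/L^kM)^d` ([Balaban1985BackgroundPropagators] (3.24) at `U = 1`) with King's 0-form block averagings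
`Q0lev` and plantings `J0pcT = √(L^d)·Q₀ᴴ` satisfies `FreeTowerLaws` with pairing defect `0`, complement defect `2d√(γ′⁻¹)·L^{−k}` and injected
defect `(2d√(γ′⁻¹) + C_X(d,a′))·L^{−k}`, `γ′ = gammaPs d a′`, `C_X = C_m(d)(1 + a′γ′⁻¹)²`, `C_m(d) = 1 + 5^d(1 + 4d)` — the «free scalar-tower
planting/complement defects» DATA of row B4.b.  Chain: complement defect (0-form block Poincaré, `ScalarPlantingDefect`) + EXACT sandwich
`J₀ᴴG′_{k+1}J₀ = (Δ̃_k + a′Π′_k)⁻¹` + Legendre comparison (`ScalarSandwichReduction`) + `Δ_k ≤ Δ̃_k ≤ Δ_k + (C_m/L^{2k})Δ_k²` (variational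
characterisation against the renormalised band-limited extension, parts 1–2). [folklore] -/
theorem freeTowerLaws_king_scalar (hd : 0 < d) (ha' : 0 < a') :
    FreeTowerLaws (fun k => DeltaPs (lev L k) M a') (Q0lev L M) (J0pcT L M) (fun _ => 0) ((L : ℝ) ^ d)
      (fun k => 2 * d * Real.sqrt ((gammaPs d a')⁻¹) * ((L : ℝ)⁻¹) ^ k)
      (fun k => (2 * d * Real.sqrt ((gammaPs d a')⁻¹) + CX d a') * ((L : ℝ)⁻¹) ^ k) (fun _ => 0) :=
  freeTowerLaws_scalar_of_excess L M a' hd ha' (CX_nonneg d a') (excess_lev L M hd ha')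

end End

end Summit.QuantumFields.BalabanUV.T4Continuum.EffectiveLaplacianExcess

end
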